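import Summits.HodgeConjecture.HodgeConjecture.Theorems.F0P2cOmegaLocalType
import Literature.NumberTheory.Automorphic.Liu2021.Def411WeilCarriersAtLineReindex
import Literature.NumberTheory.Automorphic.Liu2021.Def411WeilCarriersLocalIsotypyAtPlace
import Literature.RepresentationTheory.Liu2021.GlobalOscillatorIsomorphismCriterion
import Literature.NumberTheory.GelbartRogawski1991.FiniteAdelicWeilCentralCoinvariantsIsotypic
import Literature.NumberTheory.Automorphic.RestrictedTensorProductIrreducibleProofs
import HarnessLib

/-!
# Crux `H413`, (C) desk, sub-line `F0_P2CELocalToGlobal` — **LR: Liu's local theta type `X_v(μ, a, χ)` does NOT depend on the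
# enumeration `e : Fin 3 × Fin 1 ≃ Fin n` of `V ⊗ W`** (the re-enumeration brick: `X_v(μ,a,χ)[e₁] ≃ X_v(μ,a,χ)[e₂]` as representations of
# `U(diag dV)(L⁺_v)`, and the carrier-level transport of isotypy along any `ι`, `φ`)

Cell hodgecm-mathlib (D-0151), FLOOR 0, crux item H413 = stmt-HodgeConjecture-24833; programme P2; (C)-desk sub-line
`Cruxes/H413/Lines/F0_P2CELocalToGlobal.lean` (F0P2-plan (g4), 2026-08-31: PK + GL + LW + LT ⟹ CoreCER ⟹ CE).  Author F0P2-p04 (g3).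
THEOREMS ONLY (no `def`, no instance, no notation, no named fact, no `sorry`); `--supports stmt-HodgeConjecture-24833 --as helper`; never
imports a `Cruxes/…/Lines` module (s380b).  HC_CM is proved only modulo the printed citations until rung 0 closes; this file discharges no
printed citation.

WHY.  Every ★ LOCAL transport brick for Liu's local theta types (`MoeglinVignerasWaldspurger1987.lineTransportOp`, ★
`lineTransportOp_omegaLoc_localLineInl'`, S6a) is typed at the enumeration `Equiv.prodUnique (Fin N) (Fin 1)` («so that `𝒮(F_vⁿ) = 𝒮(F_vᴺ)`»),
while the sub-line's stubs LT ∕ PK ∕ CoreCER and the registered engine letter CE of `Lines/F0_P2CohFinComponentIsThetaC.lean` quantify over an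
ARBITRARY enumeration `{n'} (e₁ : Fin 3 × Fin 1 ≃ Fin n')` (F0P2-p02 (g2)'s LT census, bus 2026-08-31T02:52:40Z).  This file closes the gap ONCE,
by the GLOBAL route: the tree already knows that the CARRIER `ω(μ, a, χ)[e]` does not depend on `e` (★
`Def411WeilCarriersDoubling.exists_omegaAtLine_equiv_rhoVAtLine_reindex`: the χ-attached pair splittings at `e` and `e′` are equal, so `[f] ↦ [f]` is
a `U(diag dV)(𝔸_{L⁺,f})`-isomorphism ON THE NOSE), that the carrier restricted to `U(diag dV)(L⁺_v)` is ISOTYPIC of the local type `X_v[e]` (★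
`isotypicComponent_rhoAtLine_comp_eq_top_of_lemD1AsPrinted` over Lem. D.1 (1) per place ★ `F0P2cStubCI.lemD1_1AsPrinted_chi`), that `X_v[e]` is
irreducible (★ `F0P2cOmegaLocalType.isIrreducible_localType_chi`), and that a global equivalence of representations isotypic of irreducible local
types forces an equivalence of the types (★ `Liu2021.nonempty_equiv_of_isotypicComponent_eq_top` — [Flath1979, Thm 3] uniqueness clause).

* §0 `isotypicComponent_comp_eq_top_iff_of_equiv` — generic: isotypy for an irreducible type passes along a `Representation.Equiv` of the ambient
  representation pulled back along any `φ` (★ `isotypicComponent_asModule_eq_top_of_surjective` both ways);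
* §1 `rhoAtLine_chi_id_isIrreducible` — the carrier at `ι := id` is irreducible (★ `rhoAtLine_isIrreducible_of_lemD1AsPrinted`), hence non-zero;
* §2 `isotypicComponent_rhoAtLine_chi_id_comp_inclPlace` — the carrier restricted along `inclPlace v` is `X_v[e]`-isotypic (frame-free form of
  F0P2-p01 (g3)'s ★ `isotypicComponent_rhoAtLine_chi_comp_frame`);
* §3 `nonempty_equiv_rhoAtLine_chi_reindex` — `ω(μ,a,χ)[e₁] ∘ ι ≃ ω(μ,a,χ)[e₂] ∘ ι` for EVERY `ι : G →* U(diag dV)(𝔸_{L⁺,f})` (Mathlib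
  `Representation.Equiv`);
* §4 **`nonempty_equiv_localType_chi_reindex`** — LR: `X_v(μ,a,χ)[e₁] ≃ X_v(μ,a,χ)[e₂]` for all `e₁ e₂` and every finite `v`;
* §5 `isotypicComponent_rhoAtLine_chi_comp_eq_top_iff_reindex` — for every `ι`, every `φ : G' →* G` and every IRREDUCIBLE `τ` of `G'`:
  `ω[e₁] ∘ ι ∘ φ` is `τ`-isotypic iff `ω[e₂] ∘ ι ∘ φ` is (★ `isotypicComponent_asModule_eq_top_of_surjective` both ways) — the shape that moves an
  `IsLocalTypeAt … (rhoAtLine …[e] ιV a χ) v τ` conclusion (CE ∕ CoreCER ∕ PK) between enumerations;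
* §6 **`stubLR_holds`** — §4 in the exact CM spelling of F0P2-p02 (g2)'s `hLR` binder (`F0/P2/LR.hypothesis.F0P2p02g2.txt` 2742663972df4771), the
  fold target of `F0P2eStubLTLocalTypeTransport.stubLT_of_LR`.

## References
* [Liu2021] Y. Liu, Camb. J. Math. 9 (2021) = arXiv:2102.11518: Def. 4.11 (l. 2090–2096), App. D §D.1 Step 1 footnote (l. 5215), Lem. D.1 (1) (l. 5229),
  Thm. 4.18 (2) (l. 2270).
* [Flath1979] D. Flath, PSPM 33.1 (1979): Thm 3 (uniqueness clause).  [Bump1997] D. Bump, CUP 1997: §3.4 Prop. 3.4.1.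
* [GelbartRogawski1991] S. Gelbart, J. Rogawski, Invent. Math. 105 (1991): §3.1 Prop. 3.1.1, Remark p. 457 L4–13.
* [MoeglinVignerasWaldspurger1987] LNM 1291: Chap. 2 II.1 (naturality of `Mp_ψ(W)` in the model).
-/

set_option autoImplicit false
set_option linter.dupNamespace false

noncomputable section

namespace Summit.HodgeConjecture.HodgeConjecture.Cruxes.H413.F0P2eStubLRLocalReindex

open scoped Matrix Kronecker TensorProduct Classical RestrictedProduct ComplexOrder
open NumberField NumberField.mixedEmbedding IsDedekindDomain Filter Set MeasureTheory
open Literature.NumberTheory Literature.NumberTheory.Automorphic Literature.NumberTheory.Automorphic.UnitaryGroup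
open Literature.NumberTheory.GelbartRogawski1991 Literature.NumberTheory.GelbartRogawski1991.UnitaryDualPair
open Literature.NumberTheory.GelbartRogawski1991.UnitaryDualPair.WeilCoinv
open Literature.NumberTheory.Weil1964 Literature.RepresentationTheory
open Literature.RepresentationTheory.HeisenbergGroup
open Literature.GroupTheory.RestrictedProductCharacter
open Literature.NumberTheory.Automorphic.Liu2021 Literature.NumberTheory.Automorphic.Liu2021.Def411WeilCarriers
open Literature.NumberTheory.Automorphic.Liu2021.Def411WeilCarriersDoubling
open Literature.NumberTheory.Automorphic.IdeleClassGroup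
open Literature.NumberTheory.GelbartRogawski1991.UnitaryDualPair.LocalSplitting (localMu norm_localMu continuous_localMu localMu_toLocalRing_eq_one_iff)
open Literature.RepresentationTheory.Liu2021
open Summit.HodgeConjecture.CorCM.Transposition
open Summit.HodgeConjecture.CorCM.HypD1pp
open Summit.HodgeConjecture.HodgeConjecture.Cruxes.H413.F0P2cStubCI (three_le_of_equiv lemD1_1AsPrinted_chi)
open Summit.HodgeConjecture.HodgeConjecture.Cruxes.H413.F0P2cOmegaLocalType (isIrreducible_localType_chi)

/-! ## §0 A generic transport lemma (isotypy along an equivalence of the ambient representation) -/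

/-- **isotypy for an IRREDUCIBLE type passes along an equivalence of the ambient representation, pulled back along any `φ`** (generic):
for `E : ρ ≃ ρ'` (Mathlib `Representation.Equiv`) and `φ : G' →* G`, the `ℂ[G']`-module of `ρ ∘ φ` is `τ`-isotypic iff that of `ρ' ∘ φ` is
(★ `isotypicComponent_asModule_eq_top_of_surjective` in both directions). [cite: Bump1997, §3.4 Prop. 3.4.1] [cite: Flath1979, Theorem 3 (uniqueness clause)] -/
theorem isotypicComponent_comp_eq_top_iff_of_equiv {G G' V V' T : Type*} [Group G] [Group G'] [AddCommGroup V] [Module ℂ V]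
    [AddCommGroup V'] [Module ℂ V'] [AddCommGroup T] [Module ℂ T] {ρ : Representation ℂ G V} {ρ' : Representation ℂ G V'}
    (E : ρ.Equiv ρ') (φ : G' →* G) (τ : Representation ℂ G' T) [τ.IsIrreducible] :
    isotypicComponent (MonoidAlgebra ℂ G') (Representation.asModule (ρ.comp φ)) (Representation.asModule τ) = ⊤ ↔
      isotypicComponent (MonoidAlgebra ℂ G') (Representation.asModule (ρ'.comp φ)) (Representation.asModule τ) = ⊤ := by
  constructor
  · exact fun h => Literature.RepresentationTheory.isotypicComponent_asModule_eq_top_of_surjective (ρ.comp φ) (ρ'.comp φ) τ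
      E.toLinearEquiv.toLinearMap
      (fun g w => by
        change E.toIntertwiningMap (ρ (φ g) w) = ρ' (φ g) (E.toIntertwiningMap w)
        exact Representation.IntertwiningMap.isIntertwining _ _ E.toIntertwiningMap (φ g) w)
      E.toLinearEquiv.surjective h
  · exact fun h => Literature.RepresentationTheory.isotypicComponent_asModule_eq_top_of_surjective (ρ'.comp φ) (ρ.comp φ) τ
      E.symm.toLinearEquiv.toLinearMap
      (fun g w => by
        change E.symm.toIntertwiningMap (ρ' (φ g) w) = ρ (φ g) (E.symm.toIntertwiningMap w)
        exact Representation.IntertwiningMap.isIntertwining _ _ E.symm.toIntertwiningMap (φ g) w)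
      E.symm.toLinearEquiv.surjective h

section Main

variable
    (L : Type) [Field L] [NumberField L] [IsCMField L]
    (dV : Fin 3 → L) (hdV : ∀ i, IsCMField.complexConj L (dV i) = dV i) (hdV0 : ∀ i, dV i ≠ 0)
    (μ : Literature.NumberTheory.Automorphic.IdeleClassGroup L →ₜ* Circle) (hμ : IsConjugateSymplectic L μ)
    (a : (↥(maximalRealSubfield L))ˣ) (χ : Chi (↥(maximalRealSubfield L)) L (IsCMField.complexConj L))
include hμ

/-! ## §1 The carrier on `U(diag dV)(𝔸_{L⁺,f})` itself (`ι := id`) is irreducible, hence non-zero -/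

set_option synthInstance.maxHeartbeats 400000 in
set_option maxHeartbeats 8000000 in
/-- **`ω(μ, a, χ)[e₁]` is IRREDUCIBLE as a representation of `U(diag dV)(𝔸_{L⁺,f})`** (`ι := MonoidHom.id`, onto trivially): ★
`rhoAtLine_isIrreducible_of_lemD1AsPrinted` at the data `(L⁺, L, c̄, 3, e₁, diag dV, δ = imagUnit L)`, the `μ`-splitting ★ `OmegaChiSplitting.hsChiD`,
the local splittings ★ `chiLocalSplittingsD … a`, the factorisation ★ `hfac_sChiD`, Step-2 characters ★ `localMu`, Lem. D.1 (1) per place ★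
`F0P2cStubCI.lemD1_1AsPrinted_chi` (the term of ★ `F0P2cStubCI.rhoAtLine_chi_isIrreducible` with `ιV ↦ id`).
[cite: Liu2021, Def. 4.11 (l. 2090–2096), App. D Lem. D.1 (1) (l. 5229)] [cite: GelbartRogawski1991, §3.1 Prop. 3.1.1] -/
theorem rhoAtLine_chi_id_isIrreducible {n₁ : ℕ} (e₁ : Fin 3 × Fin 1 ≃ Fin n₁) :
    (rhoAtLine (↥(maximalRealSubfield L)) L (IsCMField.complexConj L) 3 e₁ (Matrix.diagonal dV) (complexConj_imagUnit L)
        (imagUnit_ne_zero L) (imagUnit_mul_self L) (realDiagonal_isSymm L dV hdV) (isUnit_det_realDiagonal L dV hdV hdV0)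
        (realDiagonal_map L dV hdV).symm
        (fun a => isCompatible_chiSplittingLine L e₁ dV hdV hdV0 (toHeckeCharacter L μ) (isUnitary_toHeckeCharacter L μ)
          ((isOscillatorChar_toHeckeCharacter_iff μ).mpr hμ) (TW (↥(maximalRealSubfield L)) a)
          (isSymm_TW (↥(maximalRealSubfield L)) a) (isUnit_det_TW (↥(maximalRealSubfield L)) a)
          (JW (↥(maximalRealSubfield L)) L a) (JW_eq (↥(maximalRealSubfield L)) L a))
        (MonoidHom.id (finAdelic (↥(maximalRealSubfield L)) L (IsCMField.complexConj L) 3 (Matrix.diagonal dV))) a χ).IsIrreducible := by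
  have hn : 3 ≤ n₁ := three_le_of_equiv e₁
  exact
    (Def411WeilCarriers.rhoAtLine_isIrreducible_of_lemD1AsPrinted ↥(maximalRealSubfield L) L (IsCMField.complexConj L) 3 e₁
        (Matrix.diagonal dV) (complexConj_imagUnit L) (imagUnit_ne_zero L) (imagUnit_mul_self L)
        (realDiagonal_isSymm L dV hdV) (isUnit_det_realDiagonal L dV hdV hdV0)
        (realDiagonal_map L dV hdV).symm
        (OmegaChiSplitting.hsChiD ⟨L⟩ e₁ dV hdV hdV0 (toHeckeCharacter L μ) (isUnitary_toHeckeCharacter L μ)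
        ((isOscillatorChar_toHeckeCharacter_iff μ).mpr hμ))
        a χ
        (OmegaChiSplitting.chiLocalSplittingsD ⟨L⟩ e₁ dV hdV hdV0 (toHeckeCharacter L μ)
        ((isOscillatorChar_toHeckeCharacter_iff μ).mpr hμ) a)
        (ι := MonoidHom.id _) Function.surjective_id
        (OmegaChiSplitting.hfac_sChiD ⟨L⟩ e₁ dV hdV hdV0 (toHeckeCharacter L μ) (isUnitary_toHeckeCharacter L μ)
        ((isOscillatorChar_toHeckeCharacter_iff μ).mpr hμ) a)
        hn (localMu L (toHeckeCharacter L μ)) (fun v x => norm_localMu L (toHeckeCharacter L μ) v (isUnitary_toHeckeCharacter L μ) x)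
        (continuous_localMu L (toHeckeCharacter L μ))
        (fun v t => localMu_toLocalRing_eq_one_iff L (toHeckeCharacter L μ) v ((isOscillatorChar_toHeckeCharacter_iff μ).mpr hμ) t)
        (fun v => lemD1_1AsPrinted_chi L e₁ dV hdV hdV0 hn μ hμ a χ v))

/-! ## §2 The carrier restricted along `inclPlace v` is `X_v[e]`-isotypic (frame-free) -/

set_option synthInstance.maxHeartbeats 400000 in
set_option maxHeartbeats 8000000 in
/-- **`ω(μ, a, χ)[e₁]` restricted along `inclPlace v : U(diag dV)(L⁺_v) → U(diag dV)(𝔸_{L⁺,f})` is `X_v(μ, a, χ)[e₁]`-ISOTYPIC** — ★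
`isotypicComponent_rhoAtLine_comp_eq_top_of_lemD1AsPrinted` at `ι := id`, `φ' := inclPlace v` (`hφ'` by `rfl`); the data as in §1.  (The frame
form along `ι_v^H ∘ κ_v` is F0P2-p01 (g3)'s ★ `F0P2cOmegaLocalType.isotypicComponent_rhoAtLine_chi_comp_frame`.)
[cite: Liu2021, Def. 4.11 (l. 2090–2096), App. D Lem. D.1 (1) (l. 5229), Thm. 4.18 (2) (l. 2270)] [cite: GelbartRogawski1991, §3.1 Prop. 3.1.1]
[cite: Flath1979, §2 Example 2 and Theorem 3] -/
theorem isotypicComponent_rhoAtLine_chi_id_comp_inclPlace {n₁ : ℕ} (e₁ : Fin 3 × Fin 1 ≃ Fin n₁)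
    (v : HeightOneSpectrum (𝓞 ↥(maximalRealSubfield L))) :
    isotypicComponent (MonoidAlgebra ℂ (localPi L (IsCMField.complexConj L) 3 (Matrix.diagonal dV) v))
      (Representation.asModule
        ((rhoAtLine (↥(maximalRealSubfield L)) L (IsCMField.complexConj L) 3 e₁ (Matrix.diagonal dV) (complexConj_imagUnit L)
              (imagUnit_ne_zero L) (imagUnit_mul_self L) (realDiagonal_isSymm L dV hdV) (isUnit_det_realDiagonal L dV hdV hdV0)
              (realDiagonal_map L dV hdV).symm
              (fun a => isCompatible_chiSplittingLine L e₁ dV hdV hdV0 (toHeckeCharacter L μ) (isUnitary_toHeckeCharacter L μ)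
                ((isOscillatorChar_toHeckeCharacter_iff μ).mpr hμ) (TW (↥(maximalRealSubfield L)) a)
                (isSymm_TW (↥(maximalRealSubfield L)) a) (isUnit_det_TW (↥(maximalRealSubfield L)) a)
                (JW (↥(maximalRealSubfield L)) L a) (JW_eq (↥(maximalRealSubfield L)) L a))
              (MonoidHom.id (finAdelic (↥(maximalRealSubfield L)) L (IsCMField.complexConj L) 3 (Matrix.diagonal dV))) a χ).comp
          (inclPlace (↥(maximalRealSubfield L)) L (IsCMField.complexConj L) 3 (Matrix.diagonal dV) v)))
      (Representation.asModule (show Representation ℂ (localPi L (IsCMField.complexConj L) 3 (Matrix.diagonal dV) v) _ from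
        (TwistedCoinv.rep (localCharOfCenter (↥(maximalRealSubfield L)) L (IsCMField.complexConj L)
            (JW (↥(maximalRealSubfield L)) L a) (JW_apply_ne_zero (↥(maximalRealSubfield L)) L a) χ.1 v)
          ((OmegaChiSplitting.chiLocalSplittingsD ⟨L⟩ e₁ dV hdV hdV0 (toHeckeCharacter L μ)
            ((isOscillatorChar_toHeckeCharacter_iff μ).mpr hμ) a).omegaLoc v)
          (commute_omegaLoc_localCenter (↥(maximalRealSubfield L)) L (IsCMField.complexConj L) 3 e₁ (Matrix.diagonal dV)
            (JW (↥(maximalRealSubfield L)) L a) (complexConj_imagUnit L) (imagUnit_ne_zero L) (imagUnit_mul_self L)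
            (realDiagonal_isSymm L dV hdV) (isSymm_TW (↥(maximalRealSubfield L)) a) (realDiagonal_map L dV hdV).symm
            (JW_eq (↥(maximalRealSubfield L)) L a) (JW_apply_ne_zero (↥(maximalRealSubfield L)) L a)
            (OmegaChiSplitting.chiLocalSplittingsD ⟨L⟩ e₁ dV hdV hdV0 (toHeckeCharacter L μ)
              ((isOscillatorChar_toHeckeCharacter_iff μ).mpr hμ) a) v)).comp
          (UnitaryGroup.localLineInl L (IsCMField.complexConj L) 3 e₁ (Matrix.diagonal dV) (JW (↥(maximalRealSubfield L)) L a) v))) = ⊤ := by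
  have hn : 3 ≤ n₁ := three_le_of_equiv e₁
  exact isotypicComponent_rhoAtLine_comp_eq_top_of_lemD1AsPrinted (↥(maximalRealSubfield L)) L (IsCMField.complexConj L) 3 e₁
    (Matrix.diagonal dV) (complexConj_imagUnit L) (imagUnit_ne_zero L) (imagUnit_mul_self L)
    (realDiagonal_isSymm L dV hdV) (isUnit_det_realDiagonal L dV hdV hdV0) (realDiagonal_map L dV hdV).symm
    (OmegaChiSplitting.hsChiD ⟨L⟩ e₁ dV hdV hdV0 (toHeckeCharacter L μ) (isUnitary_toHeckeCharacter L μ)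
      ((isOscillatorChar_toHeckeCharacter_iff μ).mpr hμ))
    a χ
    (OmegaChiSplitting.chiLocalSplittingsD ⟨L⟩ e₁ dV hdV hdV0 (toHeckeCharacter L μ)
      ((isOscillatorChar_toHeckeCharacter_iff μ).mpr hμ) a)
    (ι := MonoidHom.id _)
    (OmegaChiSplitting.hfac_sChiD ⟨L⟩ e₁ dV hdV hdV0 (toHeckeCharacter L μ) (isUnitary_toHeckeCharacter L μ)
      ((isOscillatorChar_toHeckeCharacter_iff μ).mpr hμ) a)
    hn (localMu L (toHeckeCharacter L μ)) (fun v x => norm_localMu L (toHeckeCharacter L μ) v (isUnitary_toHeckeCharacter L μ) x)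
    (continuous_localMu L (toHeckeCharacter L μ))
    (fun v t => localMu_toLocalRing_eq_one_iff L (toHeckeCharacter L μ) v ((isOscillatorChar_toHeckeCharacter_iff μ).mpr hμ) t)
    (fun v => lemD1_1AsPrinted_chi L e₁ dV hdV hdV0 hn μ hμ a χ v) v
    (inclPlace (↥(maximalRealSubfield L)) L (IsCMField.complexConj L) 3 (Matrix.diagonal dV) v) (fun _ => rfl)

/-! ## §3 The carriers at two enumerations are isomorphic along every `ι` -/

set_option synthInstance.maxHeartbeats 400000 in
set_option maxHeartbeats 8000000 in
/-- **ENUMERATION INDEPENDENCE OF THE CARRIER, along any transport `ι : G →* U(diag dV)(𝔸_{L⁺,f})`**: `ω(μ,a,χ)[e₁] ∘ ι ≃ ω(μ,a,χ)[e₂] ∘ ι`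
(Mathlib `Representation.Equiv`) — ★ `exists_omegaAtLine_equiv_rhoVAtLine_reindex` (`[f] ↦ [f]`, `rhoVAtLine`-equivariant ON THE NOSE) read
through `rhoAtLine … ι = rhoVAtLine ∘ ι` (★ `rhoAtLine_apply`, `rfl`).
[cite: Liu2021, Def. 4.11 (l. 2092–2096); App. D §D.1 Step 1 footnote (l. 5215)] [cite: GelbartRogawski1991, §3.1 Remark p. 457 L4–13]
[cite: MoeglinVignerasWaldspurger1987, Chap. 2 II.1] -/
theorem nonempty_equiv_rhoAtLine_chi_reindex {n₁ : ℕ} (e₁ : Fin 3 × Fin 1 ≃ Fin n₁) {n₂ : ℕ} (e₂ : Fin 3 × Fin 1 ≃ Fin n₂)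
    {G : Type*} [Group G] (ι : G →* finAdelic (↥(maximalRealSubfield L)) L (IsCMField.complexConj L) 3 (Matrix.diagonal dV)) :
    Nonempty
      ((rhoAtLine (↥(maximalRealSubfield L)) L (IsCMField.complexConj L) 3 e₁ (Matrix.diagonal dV) (complexConj_imagUnit L)
          (imagUnit_ne_zero L) (imagUnit_mul_self L) (realDiagonal_isSymm L dV hdV) (isUnit_det_realDiagonal L dV hdV hdV0)
          (realDiagonal_map L dV hdV).symm
          (fun a => isCompatible_chiSplittingLine L e₁ dV hdV hdV0 (toHeckeCharacter L μ) (isUnitary_toHeckeCharacter L μ)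
            ((isOscillatorChar_toHeckeCharacter_iff μ).mpr hμ) (TW (↥(maximalRealSubfield L)) a)
            (isSymm_TW (↥(maximalRealSubfield L)) a) (isUnit_det_TW (↥(maximalRealSubfield L)) a)
            (JW (↥(maximalRealSubfield L)) L a) (JW_eq (↥(maximalRealSubfield L)) L a)) ι a χ).Equiv
        (rhoAtLine (↥(maximalRealSubfield L)) L (IsCMField.complexConj L) 3 e₂ (Matrix.diagonal dV) (complexConj_imagUnit L)
          (imagUnit_ne_zero L) (imagUnit_mul_self L) (realDiagonal_isSymm L dV hdV) (isUnit_det_realDiagonal L dV hdV hdV0)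
          (realDiagonal_map L dV hdV).symm
          (fun a => isCompatible_chiSplittingLine L e₂ dV hdV hdV0 (toHeckeCharacter L μ) (isUnitary_toHeckeCharacter L μ)
            ((isOscillatorChar_toHeckeCharacter_iff μ).mpr hμ) (TW (↥(maximalRealSubfield L)) a)
            (isSymm_TW (↥(maximalRealSubfield L)) a) (isUnit_det_TW (↥(maximalRealSubfield L)) a)
            (JW (↥(maximalRealSubfield L)) L a) (JW_eq (↥(maximalRealSubfield L)) L a)) ι a χ)) := by
  obtain ⟨Ψ, -, hΨ⟩ := exists_omegaAtLine_equiv_rhoVAtLine_reindex L e₁ e₂ dV hdV hdV0 (toHeckeCharacter L μ)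
    (isUnitary_toHeckeCharacter L μ) ((isOscillatorChar_toHeckeCharacter_iff μ).mpr hμ) a χ
  exact ⟨Representation.Equiv.mk Ψ fun g => LinearMap.ext fun x => hΨ (ι g) x⟩

/-! ## §4 LR — Liu's local theta type does not depend on the enumeration -/

set_option synthInstance.maxHeartbeats 400000 in
set_option maxHeartbeats 8000000 in
/-- **LR — `X_v(μ, a, χ)[e₁] ≃ X_v(μ, a, χ)[e₂]` as representations of `U(diag dV)(L⁺_v)`, for ALL enumerations `e₁ e₂` and every finite
place `v`** ([Liu2021, App. D §D.1 Step 1 footnote]: the choice of basis of `V ⊗ W` is immaterial).  Proof (global route): the carriers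
`ω(μ,a,χ)[e₁] ≃ ω(μ,a,χ)[e₂]` are isomorphic on `U(diag dV)(𝔸_{L⁺,f})` (§3 at `ι := id`), the first is non-zero (§1, irreducible), each restricted
along `inclPlace v` is isotypic of the irreducible local type `X_v[eᵢ]` (§2, ★ `F0P2cOmegaLocalType.isIrreducible_localType_chi`), so the types are
isomorphic (★ `Liu2021.nonempty_equiv_of_isotypicComponent_eq_top`, [Flath1979, Thm 3] uniqueness clause).
[cite: Liu2021, Def. 4.11 (l. 2092–2096), App. D §D.1 Step 1 footnote (l. 5215), Lem. D.1 (1) (l. 5229), Thm. 4.18 (2) (l. 2270)]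
[cite: Flath1979, Theorem 3 (uniqueness clause)] [cite: Bump1997, §3.4 Prop. 3.4.1] -/
theorem nonempty_equiv_localType_chi_reindex {n₁ : ℕ} (e₁ : Fin 3 × Fin 1 ≃ Fin n₁) {n₂ : ℕ} (e₂ : Fin 3 × Fin 1 ≃ Fin n₂)
    (v : HeightOneSpectrum (𝓞 ↥(maximalRealSubfield L))) :
    Nonempty (Representation.Equiv
      (show Representation ℂ (localPi L (IsCMField.complexConj L) 3 (Matrix.diagonal dV) v) _ from
        (TwistedCoinv.rep (localCharOfCenter (↥(maximalRealSubfield L)) L (IsCMField.complexConj L)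
            (JW (↥(maximalRealSubfield L)) L a) (JW_apply_ne_zero (↥(maximalRealSubfield L)) L a) χ.1 v)
          ((OmegaChiSplitting.chiLocalSplittingsD ⟨L⟩ e₁ dV hdV hdV0 (toHeckeCharacter L μ)
            ((isOscillatorChar_toHeckeCharacter_iff μ).mpr hμ) a).omegaLoc v)
          (commute_omegaLoc_localCenter (↥(maximalRealSubfield L)) L (IsCMField.complexConj L) 3 e₁ (Matrix.diagonal dV)
            (JW (↥(maximalRealSubfield L)) L a) (complexConj_imagUnit L) (imagUnit_ne_zero L) (imagUnit_mul_self L)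
            (realDiagonal_isSymm L dV hdV) (isSymm_TW (↥(maximalRealSubfield L)) a) (realDiagonal_map L dV hdV).symm
            (JW_eq (↥(maximalRealSubfield L)) L a) (JW_apply_ne_zero (↥(maximalRealSubfield L)) L a)
            (OmegaChiSplitting.chiLocalSplittingsD ⟨L⟩ e₁ dV hdV hdV0 (toHeckeCharacter L μ)
              ((isOscillatorChar_toHeckeCharacter_iff μ).mpr hμ) a) v)).comp
          (UnitaryGroup.localLineInl L (IsCMField.complexConj L) 3 e₁ (Matrix.diagonal dV) (JW (↥(maximalRealSubfield L)) L a) v))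
      (show Representation ℂ (localPi L (IsCMField.complexConj L) 3 (Matrix.diagonal dV) v) _ from
        (TwistedCoinv.rep (localCharOfCenter (↥(maximalRealSubfield L)) L (IsCMField.complexConj L)
            (JW (↥(maximalRealSubfield L)) L a) (JW_apply_ne_zero (↥(maximalRealSubfield L)) L a) χ.1 v)
          ((OmegaChiSplitting.chiLocalSplittingsD ⟨L⟩ e₂ dV hdV hdV0 (toHeckeCharacter L μ)
            ((isOscillatorChar_toHeckeCharacter_iff μ).mpr hμ) a).omegaLoc v)
          (commute_omegaLoc_localCenter (↥(maximalRealSubfield L)) L (IsCMField.complexConj L) 3 e₂ (Matrix.diagonal dV)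
            (JW (↥(maximalRealSubfield L)) L a) (complexConj_imagUnit L) (imagUnit_ne_zero L) (imagUnit_mul_self L)
            (realDiagonal_isSymm L dV hdV) (isSymm_TW (↥(maximalRealSubfield L)) a) (realDiagonal_map L dV hdV).symm
            (JW_eq (↥(maximalRealSubfield L)) L a) (JW_apply_ne_zero (↥(maximalRealSubfield L)) L a)
            (OmegaChiSplitting.chiLocalSplittingsD ⟨L⟩ e₂ dV hdV hdV0 (toHeckeCharacter L μ)
              ((isOscillatorChar_toHeckeCharacter_iff μ).mpr hμ) a) v)).comp
          (UnitaryGroup.localLineInl L (IsCMField.complexConj L) 3 e₂ (Matrix.diagonal dV) (JW (↥(maximalRealSubfield L)) L a) v))) := by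
  -- the carrier at `e₁` (on `U(diag dV)(𝔸_{L⁺,f})` itself) is irreducible, hence non-zero
  haveI hρ := rhoAtLine_chi_id_isIrreducible L dV hdV hdV0 μ hμ a χ e₁
  haveI := Representation.IsIrreducible.nontrivial
    (rhoAtLine (↥(maximalRealSubfield L)) L (IsCMField.complexConj L) 3 e₁ (Matrix.diagonal dV) (complexConj_imagUnit L)
        (imagUnit_ne_zero L) (imagUnit_mul_self L) (realDiagonal_isSymm L dV hdV) (isUnit_det_realDiagonal L dV hdV hdV0)
        (realDiagonal_map L dV hdV).symm
        (fun a => isCompatible_chiSplittingLine L e₁ dV hdV hdV0 (toHeckeCharacter L μ) (isUnitary_toHeckeCharacter L μ)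
          ((isOscillatorChar_toHeckeCharacter_iff μ).mpr hμ) (TW (↥(maximalRealSubfield L)) a)
          (isSymm_TW (↥(maximalRealSubfield L)) a) (isUnit_det_TW (↥(maximalRealSubfield L)) a)
          (JW (↥(maximalRealSubfield L)) L a) (JW_eq (↥(maximalRealSubfield L)) L a))
        (MonoidHom.id (finAdelic (↥(maximalRealSubfield L)) L (IsCMField.complexConj L) 3 (Matrix.diagonal dV))) a χ)
  -- both local types are irreducible (Lem. D.1 (1) per place)
  haveI hX₁ := isIrreducible_localType_chi L e₁ dV hdV hdV0 μ hμ a χ v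
  haveI hX₂ := isIrreducible_localType_chi L e₂ dV hdV hdV0 μ hμ a χ v
  -- the global equivalence at `ι := id`
  obtain ⟨E⟩ := nonempty_equiv_rhoAtLine_chi_reindex L dV hdV hdV0 μ hμ a χ e₁ e₂
    (MonoidHom.id (finAdelic (↥(maximalRealSubfield L)) L (IsCMField.complexConj L) 3 (Matrix.diagonal dV)))
  exact Literature.RepresentationTheory.Liu2021.nonempty_equiv_of_isotypicComponent_eq_top
    (inclPlace (↥(maximalRealSubfield L)) L (IsCMField.complexConj L) 3 (Matrix.diagonal dV) v) E
    (isotypicComponent_rhoAtLine_chi_id_comp_inclPlace L dV hdV hdV0 μ hμ a χ e₁ v)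
    (isotypicComponent_rhoAtLine_chi_id_comp_inclPlace L dV hdV hdV0 μ hμ a χ e₂ v)

/-! ## §5 Isotypy of `ω[e] ∘ ι ∘ φ` for an irreducible type does not depend on `e` -/


set_option synthInstance.maxHeartbeats 400000 in
set_option maxHeartbeats 8000000 in
/-- **The CE ∕ CoreCER ∕ PK-shaped transport between enumerations**: for every transport `ι : G →* U(diag dV)(𝔸_{L⁺,f})` (e.g. the frame
transport `ιV` of the (C) socket), every `φ : G' →* G` (e.g. `inclPlace_H v`, or `inclPlace_H v ∘ κ_v`) and every IRREDUCIBLE representation `τ`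
of `G'`, the `ℂ[G']`-module of `ω(μ,a,χ)[e₁] ∘ ι ∘ φ` is `τ`-isotypic iff that of `ω(μ,a,χ)[e₂] ∘ ι ∘ φ` is — isotypy passes along the equivariant
bijection of §3 in both directions (★ `isotypicComponent_asModule_eq_top_of_surjective`).  So an `IsLocalTypeAt … (rhoAtLine …[e] ιV a χ) v τ`
conclusion proved at ONE enumeration holds at every enumeration.
[cite: Liu2021, Def. 4.11 (l. 2092–2096), App. D §D.1 Step 1 footnote (l. 5215)] [cite: Bump1997, §3.4 Prop. 3.4.1] [cite: Flath1979, Theorem 3 (uniqueness clause)] -/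
theorem isotypicComponent_rhoAtLine_chi_comp_eq_top_iff_reindex {n₁ : ℕ} (e₁ : Fin 3 × Fin 1 ≃ Fin n₁) {n₂ : ℕ}
    (e₂ : Fin 3 × Fin 1 ≃ Fin n₂)
    {G : Type*} [Group G] (ι : G →* finAdelic (↥(maximalRealSubfield L)) L (IsCMField.complexConj L) 3 (Matrix.diagonal dV))
    {G' : Type*} [Group G'] (φ : G' →* G) {T : Type*} [AddCommGroup T] [Module ℂ T] (τ : Representation ℂ G' T) [τ.IsIrreducible] :
    isotypicComponent (MonoidAlgebra ℂ G')
        (Representation.asModule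
          ((rhoAtLine (↥(maximalRealSubfield L)) L (IsCMField.complexConj L) 3 e₁ (Matrix.diagonal dV) (complexConj_imagUnit L)
              (imagUnit_ne_zero L) (imagUnit_mul_self L) (realDiagonal_isSymm L dV hdV) (isUnit_det_realDiagonal L dV hdV hdV0)
              (realDiagonal_map L dV hdV).symm
              (fun a => isCompatible_chiSplittingLine L e₁ dV hdV hdV0 (toHeckeCharacter L μ) (isUnitary_toHeckeCharacter L μ)
                ((isOscillatorChar_toHeckeCharacter_iff μ).mpr hμ) (TW (↥(maximalRealSubfield L)) a)
                (isSymm_TW (↥(maximalRealSubfield L)) a) (isUnit_det_TW (↥(maximalRealSubfield L)) a)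
                (JW (↥(maximalRealSubfield L)) L a) (JW_eq (↥(maximalRealSubfield L)) L a)) ι a χ).comp φ))
        (Representation.asModule τ) = ⊤ ↔
      isotypicComponent (MonoidAlgebra ℂ G')
        (Representation.asModule
          ((rhoAtLine (↥(maximalRealSubfield L)) L (IsCMField.complexConj L) 3 e₂ (Matrix.diagonal dV) (complexConj_imagUnit L)
              (imagUnit_ne_zero L) (imagUnit_mul_self L) (realDiagonal_isSymm L dV hdV) (isUnit_det_realDiagonal L dV hdV hdV0)
              (realDiagonal_map L dV hdV).symm
              (fun a => isCompatible_chiSplittingLine L e₂ dV hdV hdV0 (toHeckeCharacter L μ) (isUnitary_toHeckeCharacter L μ)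
                ((isOscillatorChar_toHeckeCharacter_iff μ).mpr hμ) (TW (↥(maximalRealSubfield L)) a)
                (isSymm_TW (↥(maximalRealSubfield L)) a) (isUnit_det_TW (↥(maximalRealSubfield L)) a)
                (JW (↥(maximalRealSubfield L)) L a) (JW_eq (↥(maximalRealSubfield L)) L a)) ι a χ).comp φ))
        (Representation.asModule τ) = ⊤ := by
  obtain ⟨E⟩ := nonempty_equiv_rhoAtLine_chi_reindex L dV hdV hdV0 μ hμ a χ e₁ e₂ ι
  exact isotypicComponent_comp_eq_top_iff_of_equiv E φ τ


end Main

/-! ## §6 The stub closer in the CM spelling F0P2-p02 (g2)'s LT closer consumes (`F0/P2/LR.hypothesis.F0P2p02g2.txt` 2742663972df4771, VERBATIM) -/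

set_option synthInstance.maxHeartbeats 400000 in
set_option maxHeartbeats 8000000 in
/-- **stub LR — `stubLR_holds`**: for every CM field `L`, all enumerations `e e'`, every real non-zero diagonal frame `dV`, every
conjugate-symplectic `μ`, every line `a ∈ (L⁺)ˣ`, every `χ` and every finite place `v` of `L⁺`, Liu's local theta types at `e` and at `e'` are
isomorphic representations of `U(diag dV)(L⁺_v)` — the hypothesis `hLR` of F0P2-p02 (g2)'s `F0P2eStubLTLocalTypeTransport.stubLT_of_LR` TOKEN FOR
TOKEN (so that `stub_LT_localTypeTransport := F0P2eStubLTLocalTypeTransport.stubLT_of_LR F0P2eStubLRLocalReindex.stubLR_holds` is the fold); the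
term is §4. [cite: Liu2021, Def. 4.11 (l. 2092–2096), App. D §D.1 Step 1 footnote (l. 5215), Lem. D.1 (1) (l. 5229), Thm. 4.18 (2) (l. 2270)]
[cite: Flath1979, Theorem 3 (uniqueness clause)] -/
theorem stubLR_holds :
    ∀ (L : Type) [Field L] [NumberField L] [IsCMField L] {n n' : ℕ} (e : Fin 3 × Fin 1 ≃ Fin n) (e' : Fin 3 × Fin 1 ≃ Fin n')
      (dV : Fin 3 → L) (hdV : ∀ i, IsCMField.complexConj L (dV i) = dV i) (hdV0 : ∀ i, dV i ≠ 0)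
      (μ : Literature.NumberTheory.Automorphic.IdeleClassGroup L →ₜ* Circle) (hμ : IsConjugateSymplectic L μ)
      (a : (↥(maximalRealSubfield L))ˣ) (χ : Chi (↥(maximalRealSubfield L)) L (IsCMField.complexConj L))
      (v : HeightOneSpectrum (𝓞 ↥(maximalRealSubfield L))),
      Nonempty (Representation.Equiv
        (show Representation ℂ (localPi L (IsCMField.complexConj L) 3 (Matrix.diagonal dV) v) _ from
          (TwistedCoinv.rep (localCharOfCenter (↥(maximalRealSubfield L)) L (IsCMField.complexConj L)
              (JW (↥(maximalRealSubfield L)) L a) (JW_apply_ne_zero (↥(maximalRealSubfield L)) L a) χ.1 v)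
            ((OmegaChiSplitting.chiLocalSplittingsD ⟨L⟩ e dV hdV hdV0 (toHeckeCharacter L μ)
              ((isOscillatorChar_toHeckeCharacter_iff μ).mpr hμ) a).omegaLoc v)
            (commute_omegaLoc_localCenter (↥(maximalRealSubfield L)) L (IsCMField.complexConj L) 3 e (Matrix.diagonal dV)
              (JW (↥(maximalRealSubfield L)) L a) (complexConj_imagUnit L) (imagUnit_ne_zero L) (imagUnit_mul_self L)
              (realDiagonal_isSymm L dV hdV) (isSymm_TW (↥(maximalRealSubfield L)) a) (realDiagonal_map L dV hdV).symm
              (JW_eq (↥(maximalRealSubfield L)) L a) (JW_apply_ne_zero (↥(maximalRealSubfield L)) L a)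
              (OmegaChiSplitting.chiLocalSplittingsD ⟨L⟩ e dV hdV hdV0 (toHeckeCharacter L μ)
                ((isOscillatorChar_toHeckeCharacter_iff μ).mpr hμ) a) v)).comp
            (UnitaryGroup.localLineInl L (IsCMField.complexConj L) 3 e (Matrix.diagonal dV) (JW (↥(maximalRealSubfield L)) L a) v))
        (show Representation ℂ (localPi L (IsCMField.complexConj L) 3 (Matrix.diagonal dV) v) _ from
          (TwistedCoinv.rep (localCharOfCenter (↥(maximalRealSubfield L)) L (IsCMField.complexConj L)
              (JW (↥(maximalRealSubfield L)) L a) (JW_apply_ne_zero (↥(maximalRealSubfield L)) L a) χ.1 v)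
            ((OmegaChiSplitting.chiLocalSplittingsD ⟨L⟩ e' dV hdV hdV0 (toHeckeCharacter L μ)
              ((isOscillatorChar_toHeckeCharacter_iff μ).mpr hμ) a).omegaLoc v)
            (commute_omegaLoc_localCenter (↥(maximalRealSubfield L)) L (IsCMField.complexConj L) 3 e' (Matrix.diagonal dV)
              (JW (↥(maximalRealSubfield L)) L a) (complexConj_imagUnit L) (imagUnit_ne_zero L) (imagUnit_mul_self L)
              (realDiagonal_isSymm L dV hdV) (isSymm_TW (↥(maximalRealSubfield L)) a) (realDiagonal_map L dV hdV).symm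
              (JW_eq (↥(maximalRealSubfield L)) L a) (JW_apply_ne_zero (↥(maximalRealSubfield L)) L a)
              (OmegaChiSplitting.chiLocalSplittingsD ⟨L⟩ e' dV hdV hdV0 (toHeckeCharacter L μ)
                ((isOscillatorChar_toHeckeCharacter_iff μ).mpr hμ) a) v)).comp
            (UnitaryGroup.localLineInl L (IsCMField.complexConj L) 3 e' (Matrix.diagonal dV) (JW (↥(maximalRealSubfield L)) L a) v))) :=
  fun L _ _ _ _ _ e e' dV hdV hdV0 μ hμ a χ v => nonempty_equiv_localType_chi_reindex L dV hdV hdV0 μ hμ a χ e e' v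

end Summit.HodgeConjecture.HodgeConjecture.Cruxes.H413.F0P2eStubLRLocalReindex

end
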